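import Summits.BirchSwinnertonDyer.BirchSwinnertonDyer.Theorems.UniversalToricDescentKernelDegreeOnlyTwinTMuPointwise
import Summits.BirchSwinnertonDyer.BirchSwinnertonDyer.Theorems.UniversalToricDescentTwinMuZeroAtThreeTOfBuckets
import HarnessLib

/-!
# Route `UniversalToricDescent` — the INTEGRAL road's kernel⁵ with the twin's ANALYTIC `μ = 0` in RK-7's T-SHAPE
# (part 2/2: trichotomy, package, hK′ by text): `kernelDeg_of_tText`

Width prover `bsd-wall-utd-p1-w2` g7 under LEAD `bsd-wall-utd-p1` g20 (`--supports stmt-BirchSwinnertonDyer-20400`); see part 1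
(`…KernelDegreeOnlyTwinTMuPointwise`) for the reading. Here: §3″ kernel⁵'s twin trichotomy with the analytic `μ` of the twin's frames
taken from the displayed T-text `hT` (= `TwinMuZeroAtThreeT`, pen sketch 51f2aaf68cacd05b, VERBATIM) at the bucket's disjunct, §4″
the package level and **hK′** `kernelDeg_of_tText` = the text of item 22543 (`ToricKernelAtThreeApZeroOddDegreeOfPrint`) with
`TwinMuZeroAtThree ↦ T-text`, all other antecedents BY NAME (the kernel of record p640116 is the instance
`kernelDeg_of_tText hF hD hA (…KernelRationalRoadOddT.tText_of_twinMuZeroAtThree hM) …` — same statement, not re-landed). CONSEQUENCE FOR RK-7 (memo item 4): with `…OddTMuOfR2.kernelRat_of_r2Text_of_tText`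
(hKr′) and this file (hK′), BOTH kernels of the `closes` cone run on `TwinMuZeroAtThreeT`; after the pen files the T item and the two
successor kernels, each closer is ONE `exact`, and 20400 can leave the cone by `--drop` from the package role. RK-7 v2 (pen g9,
Option B, `PEN-MEMO-RK7-v2.md`): no T item; the kernels take `BCSMuZeroInput → TwinMuZeroAtThreeMultOdd →` instead — that is
`kernelDeg_of_bcs422_of_multOdd` below (hK″ by text), composed from the T-shape and w2 g7's glue p722155.

THEOREMS ONLY; no definition, no named fact, no `sorry`. HONEST FRAMING: implications between route items / candidate texts and
displayed hypotheses; BSD is proved for no curve by this file; 23042 / 20395 / 20400 / 27120 / 24207 stay OPEN; RK-7 needs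
director GO. References: [GreenbergVatsal2000] Thm. (1.4), Prop. (2.8); [JetchevSkinnerWan2017] §7.4.1; [FriedbergHoffstein1995] Thm. B.
-/

noncomputable section

open scoped Classical

set_option linter.dupNamespace false
set_option autoImplicit false

namespace Summit.BirchSwinnertonDyer.BirchSwinnertonDyer.Theorems.UniversalToricDescentKernelDegreeOnlyTwinT

open WeierstrassCurve NumberField IsDedekindDomain Field
  Literature.NumberTheory.EllipticCurves
  Literature.NumberTheory.EllipticCurves.ModularForms
  Literature.NumberTheory.EllipticCurves.Rank1Residual
  Literature.NumberTheory.EllipticCurves.KrizLi2019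
  Literature.NumberTheory.EllipticCurves.LiuZhangZhang2018
  Summit.BirchSwinnertonDyer.Rank1Residual
  Summit.BirchSwinnertonDyer.Rank1Residual.Additive
  Summit.BirchSwinnertonDyer.Rank1Residual.X11b
  Summit.BirchSwinnertonDyer.Rank1Residual.X11b.AcSelmer
  Summit.BirchSwinnertonDyer.Rank1Residual.X11b.Halves
  Summit.BirchSwinnertonDyer.BirchSwinnertonDyer.Theses.UniversalToricDescent
  Summit.BirchSwinnertonDyer.BirchSwinnertonDyer.Theorems
  Summit.BirchSwinnertonDyer.BirchSwinnertonDyer.Theorems.UniversalToricDescentTwinChoice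
  Summit.BirchSwinnertonDyer.BirchSwinnertonDyer.Theorems.UniversalToricDescentWaldspurgerFlat
  Summit.BirchSwinnertonDyer.BirchSwinnertonDyer.Theorems.UniversalToricDescentKernelOdd
  Summit.BirchSwinnertonDyer.BirchSwinnertonDyer.Theorems.UniversalToricDescentKernelOfPrint
  Summit.BirchSwinnertonDyer.BirchSwinnertonDyer.Theorems.UniversalToricDescentKernelFlatOfPrint
  Summit.BirchSwinnertonDyer.BirchSwinnertonDyer.Theorems.UniversalToricDescentActDFlatGlue
  Summit.BirchSwinnertonDyer.BirchSwinnertonDyer.Theorems.UniversalToricDescentNormProfile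
  Summit.BirchSwinnertonDyer.BirchSwinnertonDyer.Theorems.UniversalToricDescentDefectTransport
  Summit.BirchSwinnertonDyer.BirchSwinnertonDyer.Theorems.UniversalToricDescentDefectPTSqueeze
  Summit.BirchSwinnertonDyer.BirchSwinnertonDyer.Theorems.UniversalToricDescentKernelDefectPTOfPrint
  Summit.BirchSwinnertonDyer.BirchSwinnertonDyer.Theorems.UniversalToricDescentKernelDefectPTTROfPrint
  Summit.BirchSwinnertonDyer.BirchSwinnertonDyer.Theorems.UniversalToricDescentKernelDegreeOnlyTwin
  Summit.BirchSwinnertonDyer.BirchSwinnertonDyer.Theorems.UniversalToricDescentKernelDegreeOnlyTwinOfPrint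

/-! ### §3″ The twin trichotomy on the degree package, twin analytic μ from the T-text -/

/-- **kernel⁵'s trichotomy on the degree package, twin ANALYTIC `μ = 0` from RK-7's T-TEXT** =
`…KernelDegreeOnlyTwinOfPrint.bsdp_three_of_defectPT_of_degreeBucketsTR_odd` (p640116 §3) VERBATIM except that the by-name binder
`TwinMuZeroAtThree` is replaced by the displayed hypothesis `hT` = the text of `TwinMuZeroAtThreeT` (`RK7_sketch_pen_g8.lean`
51f2aaf68cacd05b) and the pointwise kernel is §2″: in each bucket the kernel's pointwise analytic-`μ` input is `hT` at the bucket's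
disjunct (`Or.inl` GoodOrd · `Or.inr (Or.inl ·)` Mult ∧ très-ramifié · `Or.inr (Or.inr ·)` GoodSS ∧ `a₃ = 0` after the resupply).
CONDITIONAL on every displayed hypothesis; BSD is proved for no curve by this. [folklore] -/
theorem bsdp_three_of_defectPT_of_degreeBucketsTR_odd_tMu (hF : ToricPublishedInputs)
    (hD : DefectTransportModThreePT) (hwall : AdditiveSplitIMCInclusionAtThree)
    (hT : ∀ (W : WeierstrassCurve ℚ) [W.IsElliptic] [W.IsGloballyMinimal] (W' : WeierstrassCurve ℚ) [W'.IsElliptic] [W'.IsGloballyMinimal] (N N' : ℕ) [NeZero N] [NeZero N'] (K : Type) [Field K] [NumberField K] (Dt : Literature.NumberTheory.EllipticCurves.ModularForms.ModularParametrizationData W N) (Dt' : Literature.NumberTheory.EllipticCurves.ModularForms.ModularParametrizationData W' N'), Summit.BirchSwinnertonDyer.Rank1Residual.Additive.ClassO6 W 3 → W.HasSurjectiveModNGaloisRep 3 → W.analyticRank = 1 → W.conductorNorm ℤ = N → Summit.BirchSwinnertonDyer.Rank1Residual.O6.ModPCongruent W' W 3 → ¬ Literature.NumberTheory.EllipticCurves.Rank1Residual.Addv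 W' 3 → W'.conductorNorm ℤ = N' → Literature.NumberTheory.EllipticCurves.IsImaginaryQuadratic K → Literature.NumberTheory.EllipticCurves.SatisfiesHeegnerHypothesis N K → Literature.NumberTheory.EllipticCurves.SatisfiesHeegnerHypothesis N' K → Odd (NumberField.discr K) → (Literature.NumberTheory.EllipticCurves.Rank1Residual.GoodOrd W' 3 ∨ Literature.NumberTheory.EllipticCurves.Rank1Residual.Mult W' 3 ∧ ¬ 3 ∣ padicValInt 3 W'.minimalDiscriminantInt ∨ Literature.NumberTheory.EllipticCurves.Rank1Residual.GoodSS W' 3 ∧ W'.frobeniusTrace 3 = 0) → ∀ (κ : Literature.NumberTheory.EllipticCurves.ZpExtension K 3), κ.IsAnticyclotomic → ∀ (γ : Field.absoluteGaloisGroup K) [Fact (κ.IsTopGenerator γ)] (𝔭 : IsDedekindDomain.HeightOneSpectrum (NumberField.RingOfIntegers K)), ((3 : ℕ) : NumberField.RingOfIntegers K) ∈ 𝔭.asIdeal → 𝔭.asIdeal.ramificationIdx (NumberField.RingOfIntegers ℚ) = 1 → 𝔭.asIdeal.inertiaDeg (NumberField.RingOfIntegers ℚ) = 1 → ∀ (𝔭'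 : IsDedekindDomain.HeightOneSpectrum (NumberField.RingOfIntegers K)), ((3 : ℕ) : NumberField.RingOfIntegers K) ∈ 𝔭'.asIdeal → 𝔭' ≠ 𝔭 → ∀ (ι' : PadicAlgCl 3 ≃+* ℂ), Summit.BirchSwinnertonDyer.BirchSwinnertonDyer.Theorems.SchneiderFree.BranchInducesPrime 3 ι' 𝔭 → ∀ (ΩK : ℂ) (Ωp : ℂ_[3]) (L' : Literature.NumberTheory.EllipticCurves.UnrSeries 3), ΩK ≠ 0 → Ωp ≠ 0 → Literature.NumberTheory.EllipticCurves.IsBDPLFunction ι' 𝔭 κ γ Dt'.f ΩK Ωp L' → ∃ i : ℕ, ‖((PowerSeries.coeff i L' : Literature.NumberTheory.EllipticCurves.unrIntegers 3) : ℂ_[3])‖ = 1)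
    (hPT : PoitouTateSelmerStructureDualityFact) (hPT2 : PoitouTateShaTateDualFact) (hYZ : YanZhuMainConjectureInput)
    (hB : ∀ (W' : WeierstrassCurve ℚ) [W'.IsElliptic] [W'.IsGloballyMinimal] (N' : ℕ) [NeZero N'] (K : Type) [Field K]
      [NumberField K] (Dt' : ModularParametrizationData W' N'),
      Mult W' 3 → W'.HasSurjectiveModNGaloisRep 3 → W'.conductorNorm ℤ = N' → IsImaginaryQuadratic K →
      SatisfiesHeegnerHypothesis N' K → Odd (NumberField.discr K) → ¬ 3 ∣ padicValInt 3 W'.minimalDiscriminantInt →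
      ∀ (κ : ZpExtension K 3), κ.IsAnticyclotomic → ∀ (γ : absoluteGaloisGroup K) [Fact (κ.IsTopGenerator γ)]
        (𝔭 : HeightOneSpectrum (𝓞 K)), ((3 : ℕ) : 𝓞 K) ∈ 𝔭.asIdeal →
        𝔭.asIdeal.ramificationIdx (𝓞 ℚ) = 1 → 𝔭.asIdeal.inertiaDeg (𝓞 ℚ) = 1 →
        ∀ (𝔭' : HeightOneSpectrum (𝓞 K)), ((3 : ℕ) : 𝓞 K) ∈ 𝔭'.asIdeal → 𝔭' ≠ 𝔭 →
        ∀ (ι' : PadicAlgCl 3 ≃+* ℂ), SchneiderFree.BranchInducesPrime 3 ι' 𝔭 →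
        ∃ (ΩK : ℂ) (Ωp : ℂ_[3]) (L : UnrSeries 3), ΩK ≠ 0 ∧ Ωp ≠ 0 ∧ IsBDPLFunction ι' 𝔭 κ γ Dt'.f ΩK Ωp L ∧
          (Module.IsTorsion (IwasawaAlgebra 3) (XAc (W'.baseChange K) 3 κ 𝔭' ∅ γ) →
            ∀ (g : UnrSeries 3) (n m : ℕ),
              (XAc.charIdeal (W'.baseChange K) 3 κ 𝔭' ∅ γ).map (PowerSeries.map (toUnr 3)) = Ideal.span {g} →
              (∀ i < n, ‖((PowerSeries.coeff i g : unrIntegers 3) : ℂ_[3])‖ < 1) ∧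
                  ‖((PowerSeries.coeff n g : unrIntegers 3) : ℂ_[3])‖ = 1 →
              (∀ i < m, ‖((PowerSeries.coeff i L : unrIntegers 3) : ℂ_[3])‖ < 1) ∧
                  ‖((PowerSeries.coeff m L : unrIntegers 3) : ℂ_[3])‖ = 1 →
              m ≤ n))
    (hS0 : ∀ (W' : WeierstrassCurve ℚ) [W'.IsElliptic] [W'.IsGloballyMinimal] (N' : ℕ) [NeZero N'] (K : Type) [Field K]
      [NumberField K] (Dt' : ModularParametrizationData W' N'),
      GoodSS W' 3 → W'.frobeniusTrace 3 = 0 → W'.HasSurjectiveModNGaloisRep 3 → W'.conductorNorm ℤ = N' →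
      IsImaginaryQuadratic K → SatisfiesHeegnerHypothesis N' K → Odd (NumberField.discr K) →
      ∀ (κ : ZpExtension K 3), κ.IsAnticyclotomic → ∀ (γ : absoluteGaloisGroup K) [Fact (κ.IsTopGenerator γ)]
        (𝔭 : HeightOneSpectrum (𝓞 K)), ((3 : ℕ) : 𝓞 K) ∈ 𝔭.asIdeal →
        𝔭.asIdeal.ramificationIdx (𝓞 ℚ) = 1 → 𝔭.asIdeal.inertiaDeg (𝓞 ℚ) = 1 →
        ∀ (𝔭' : HeightOneSpectrum (𝓞 K)), ((3 : ℕ) : 𝓞 K) ∈ 𝔭'.asIdeal → 𝔭' ≠ 𝔭 →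
        ∀ (ι' : PadicAlgCl 3 ≃+* ℂ), SchneiderFree.BranchInducesPrime 3 ι' 𝔭 →
        ∃ (ΩK : ℂ) (Ωp : ℂ_[3]) (L : UnrSeries 3), ΩK ≠ 0 ∧ Ωp ≠ 0 ∧ IsBDPLFunction ι' 𝔭 κ γ Dt'.f ΩK Ωp L ∧
          (Module.IsTorsion (IwasawaAlgebra 3) (XAc (W'.baseChange K) 3 κ 𝔭' ∅ γ) →
            ∀ (g : UnrSeries 3) (n m : ℕ),
              (XAc.charIdeal (W'.baseChange K) 3 κ 𝔭' ∅ γ).map (PowerSeries.map (toUnr 3)) = Ideal.span {g} →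
              (∀ i < n, ‖((PowerSeries.coeff i g : unrIntegers 3) : ℂ_[3])‖ < 1) ∧
                  ‖((PowerSeries.coeff n g : unrIntegers 3) : ℂ_[3])‖ = 1 →
              (∀ i < m, ‖((PowerSeries.coeff i L : unrIntegers 3) : ℂ_[3])‖ < 1) ∧
                  ‖((PowerSeries.coeff m L : unrIntegers 3) : ℂ_[3])‖ = 1 →
              m ≤ n))
    (hsupply : ∀ (W : WeierstrassCurve ℚ) [W.IsElliptic] [W.IsGloballyMinimal], Additive.ClassO6 W 3 →
      W.analyticRank = 1 → W.HasSurjectiveModNGaloisRep 3 → HasGoodSSTwinAtThree W →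
      HasGoodSSApZeroTwinAtThree W)
    (hres : ∀ (W : WeierstrassCurve ℚ) [W.IsElliptic] [W.IsGloballyMinimal], Additive.ClassO6 W 3 →
      W.analyticRank = 1 → W.HasSurjectiveModNGaloisRep 3 →
      (∃ (W' : WeierstrassCurve ℚ) (_ : W'.IsElliptic) (_ : W'.IsGloballyMinimal),
        O6.ModPCongruent W' W 3 ∧ Mult W' 3 ∧ 3 ∣ padicValInt 3 W'.minimalDiscriminantInt) →
      ∃ (W'' : WeierstrassCurve ℚ) (_ : W''.IsElliptic) (_ : W''.IsGloballyMinimal),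
        O6.ModPCongruent W'' W 3 ∧ ¬ Addv W'' 3 ∧ (Mult W'' 3 → ¬ 3 ∣ padicValInt 3 W''.minimalDiscriminantInt))
    (hV : ∀ (W : WeierstrassCurve ℚ) [W.IsElliptic] [W.IsGloballyMinimal] (N : ℕ) [NeZero N] (K : Type)
      [Field K] [NumberField K] (Dt : ModularParametrizationData W N) (H : HeegnerDatum N (NumberField.discr K))
      (ι : K →+* ℂ) (P : (W.baseChange K).toAffine.Point),
      Additive.ClassO6 W 3 → W.HasSurjectiveModNGaloisRep 3 → W.analyticRank = 1 → W.conductorNorm ℤ = N →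
      IsImaginaryQuadratic K → SatisfiesHeegnerHypothesis N K → Odd (NumberField.discr K) →
      (W.quadraticTwist (NumberField.discr K : ℚ)).entireLFunction 1 ≠ 0 →
      (WeierstrassCurve.Affine.Point.map ι.toRatAlgHom) P = heegnerPointComplex Dt H → ¬ IsOfFinAddOrder P →
      ∀ (κ : ZpExtension K 3), κ.IsAnticyclotomic → ∀ (γ : absoluteGaloisGroup K) [Fact (κ.IsTopGenerator γ)]
        (𝔭 : HeightOneSpectrum (𝓞 K)) (h𝔭 : ((3 : ℕ) : 𝓞 K) ∈ 𝔭.asIdeal)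
        (he : 𝔭.asIdeal.ramificationIdx (𝓞 ℚ) = 1) (hf : 𝔭.asIdeal.inertiaDeg (𝓞 ℚ) = 1),
        ∃ ι' : PadicAlgCl 3 ≃+* ℂ, SchneiderFree.BranchInducesPrime 3 ι' 𝔭 ∧
          ∃ (ΩK : ℂ) (Ωp : ℂ_[3]) (L : UnrSeries 3), ΩK ≠ 0 ∧ Ωp ≠ 0 ∧ IsBDPLFunction ι' 𝔭 κ γ Dt.f ΩK Ωp L ∧
            ∃ u : (unrIntegers 3)ˣ, L.HasValueAt 0 ((((u : unrIntegers 3) : unrIntegers 3) : ℂ_[3]) *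
              (algebraMap ℚ_[3] ℂ_[3] (logOmega W 3 (embAt K 3 𝔭 h𝔭 he hf) P / (Dt.c : ℚ_[3]))) ^ 2))
    (hC : WildSplitControlAtThree) (hZ : WildRankZeroTwistAtThree) :
    ∀ (W : WeierstrassCurve ℚ) [W.IsElliptic] [W.IsGloballyMinimal], Additive.ClassO6 W 3 →
      W.analyticRank = 1 → W.HasSurjectiveModNGaloisRep 3 →
      (∃ (W' : WeierstrassCurve ℚ) (_ : W'.IsElliptic) (_ : W'.IsGloballyMinimal),
        O6.ModPCongruent W' W 3 ∧ ¬ Addv W' 3 ∧ W'.HasSurjectiveModNGaloisRep 3) → BSDp W 3 := by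
  -- VERBATIM p640116 §3; the pointwise kernel is §2″ and its analytic-μ input is `hT` at the bucket's disjunct
  intro W _ _ hO6 hr hsurj htwin
  -- the kernel at a twin OFF the peu-ramifié multiplicative locus
  have key : ∀ (W' : WeierstrassCurve ℚ) [W'.IsElliptic] [W'.IsGloballyMinimal], O6.ModPCongruent W' W 3 →
      ¬ Addv W' 3 → (Mult W' 3 → ¬ 3 ∣ padicValInt 3 W'.minimalDiscriminantInt) → BSDp W 3 := by
    intro W' _ _ hcong hW'ss htres
    have hW'surj : W'.HasSurjectiveModNGaloisRep 3 := by
      obtain ⟨e, he⟩ := hcong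
      refine GaloisImage.hasSurjectiveModNGaloisRep_of_torsionIso e.symm (fun σ Q ↦ ?_) hsurj
      apply e.injective
      rw [he, e.apply_symm_apply, e.apply_symm_apply]
    by_cases hgood : W'.HasGoodReductionAtPrime 3
    · by_cases hss : (3 : ℤ) ∣ W'.frobeniusTrace 3
      · obtain ⟨W'', hW''e, hW''m, hcong'', hW''ss, ha0⟩ :=
          hsupply W hO6 hr hsurj ⟨W', ‹_›, ‹_›, hcong, hgood, by exact_mod_cast hss⟩
        have hW''surj : W''.HasSurjectiveModNGaloisRep 3 := by
          obtain ⟨e, he⟩ := hcong''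
          refine GaloisImage.hasSurjectiveModNGaloisRep_of_torsionIso e.symm (fun σ Q ↦ ?_) hsurj
          apply e.injective
          rw [he, e.apply_symm_apply, e.apply_symm_apply]
        exact bsdp_three_of_twinDegreeFrameAt_odd_of_defectPT_tMu hF hD hwall hPT hPT2 hV hC hZ W hO6 hr hsurj W'' hcong''
          (fun h ↦ h.1 hW''ss.1)
          (fun N N' _ _ K _ _ Dt Dt' hNW hN hK hHKW hHK hodd κ hκ γ _ 𝔭 h𝔭 he hf 𝔭' h𝔭' hne ι' hι ΩK Ωp L' hΩK hΩp hL' ↦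
            hT W W'' N N' K Dt Dt' hO6 hsurj hr hNW hcong'' (fun h ↦ h.1 hW''ss.1) hN hK hHKW hHK hodd
              (Or.inr (Or.inr ⟨hW''ss, ha0⟩)) κ hκ γ 𝔭 h𝔭 he hf 𝔭' h𝔭' hne ι' hι ΩK Ωp L' hΩK hΩp hL')
          (fun N' _ K _ _ Dt' hN hK hHK hodd κ hκ γ _ 𝔭 h𝔭 he hf 𝔭' h𝔭' hne ι' hι ↦
            hS0 W'' N' K Dt' hW''ss ha0 hW''surj hN hK hHK hodd κ hκ γ 𝔭 h𝔭 he hf 𝔭' h𝔭' hne ι' hι)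
      · refine bsdp_three_of_twinDegreeFrameAt_odd_of_defectPT_tMu hF hD hwall hPT hPT2 hV hC hZ W hO6 hr hsurj W' hcong
          hW'ss
          (fun N N' _ _ K _ _ Dt Dt' hNW hN hK hHKW hHK hodd κ hκ γ _ 𝔭 h𝔭 he hf 𝔭' h𝔭' hne ι' hι ΩK Ωp L' hΩK hΩp hL' ↦
            hT W W' N N' K Dt Dt' hO6 hsurj hr hNW hcong hW'ss hN hK hHKW hHK hodd (Or.inl ⟨hgood, by exact_mod_cast hss⟩) κ hκ
              γ 𝔭 h𝔭 he hf 𝔭' h𝔭' hne ι' hι ΩK Ωp L' hΩK hΩp hL')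
          ?_
        intro N' _ K _ _ Dt' hN hK hH hodd κ hκ γ _ 𝔭 h𝔭 he hf 𝔭' h𝔭' hne ι' hι
        obtain ⟨⟨ΩK, Ωp, L', hΩK, hΩp, hBDP'⟩, hall⟩ :=
          ThreeAdicImageOverK.twinSplitIMCAtThreeGoodOrd_of_yanZhu57 hYZ W' N' K Dt'
            ⟨hgood, by exact_mod_cast hss⟩ hW'surj hN hK hH hodd κ hκ γ 𝔭 h𝔭 he hf 𝔭' h𝔭' hne ι' hι
        exact ⟨ΩK, Ωp, L', hΩK, hΩp, hBDP', fun _ ↦ degreeClause_of_eq_span (hall ΩK Ωp L' hΩK hΩp hBDP')⟩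
    · have hmult : W'.HasMultiplicativeReductionAtPrime 3 := by
        by_contra h
        exact hW'ss ⟨hgood, h⟩
      exact bsdp_three_of_twinDegreeFrameAt_odd_of_defectPT_tMu hF hD hwall hPT hPT2 hV hC hZ W hO6 hr hsurj W' hcong hW'ss
        (fun N N' _ _ K _ _ Dt Dt' hNW hN hK hHKW hHK hodd κ hκ γ _ 𝔭 h𝔭 he hf 𝔭' h𝔭' hne ι' hι ΩK Ωp L' hΩK hΩp hL' ↦
          hT W W' N N' K Dt Dt' hO6 hsurj hr hNW hcong hW'ss hN hK hHKW hHK hodd (Or.inr (Or.inl ⟨hmult, htres hmult⟩)) κ hκ γ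
            𝔭 h𝔭 he hf 𝔭' h𝔭' hne ι' hι ΩK Ωp L' hΩK hΩp hL')
        (fun N' _ K _ _ Dt' hN hK hHK hodd κ hκ γ _ 𝔭 h𝔭 he hf 𝔭' h𝔭' hne ι' hι ↦
          hB W' N' K Dt' hmult hW'surj hN hK hHK hodd (htres hmult) κ hκ γ 𝔭 h𝔭 he hf 𝔭' h𝔭' hne ι' hι)
  -- the handed twin is either off that locus (done) or resupplied off it (peu ramifié class)
  obtain ⟨W', hW'e, hW'm, hcong, hW'ss, -⟩ := htwin
  by_cases hpeu : Mult W' 3 ∧ 3 ∣ padicValInt 3 W'.minimalDiscriminantInt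
  · obtain ⟨W'', hW''e, hW''m, hcong'', hW''ss, htres''⟩ := hres W hO6 hr hsurj ⟨W', hW'e, hW'm, hcong, hpeu.1, hpeu.2⟩
    exact key W'' hcong'' hW''ss htres''
  · exact key W' hcong hW'ss (fun hm hdvd ↦ hpeu ⟨hm, hdvd⟩)

/-! ### §4″ Package level and hK′ by text -/

/-- **kernel⁵ under T, package level** = `…KernelDegreeOnlyTwinOfPrint.bsdp_three_of_degreePackage_of_print` (p640116 §5)
VERBATIM over §3″, with `TwinMuZeroAtThree` REPLACED by RK-7's T-text. CONDITIONAL on every displayed hypothesis; BSD is proved for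
no curve by this. [folklore] -/
theorem bsdp_three_of_degreePackage_of_print_of_tText (hF : ToricPublishedInputs) (hD : DefectTransportModThreePT)
    (hA : AdditiveSplitIMCInclusionAtThree)
    (hM : ∀ (W : WeierstrassCurve ℚ) [W.IsElliptic] [W.IsGloballyMinimal] (W' : WeierstrassCurve ℚ) [W'.IsElliptic] [W'.IsGloballyMinimal] (N N' : ℕ) [NeZero N] [NeZero N'] (K : Type) [Field K] [NumberField K] (Dt : Literature.NumberTheory.EllipticCurves.ModularForms.ModularParametrizationData W N) (Dt' : Literature.NumberTheory.EllipticCurves.ModularForms.ModularParametrizationData W' N'), Summit.BirchSwinnertonDyer.Rank1Residual.Additive.ClassO6 W 3 → W.HasSurjectiveModNGaloisRep 3 → W.analyticRank = 1 → W.conductorNorm ℤ = N → Summit.BirchSwinnertonDyer.Rank1Residual.O6.ModPCongruent W' W 3 → ¬ Literature.NumberTheory.EllipticCurves.Rank1Residual.Addv W' 3 → W'.conductorNorm ℤ = N' → Literature.NumberTheory.EllipticCurves.IsImaginaryQuadratic K → Literature.NumberTheory.EllipticCurves.SatisfiesHeegnerHypothesis N K → Literature.NumberTheory.EllipticCurves.SatisfiesHeegnerHypothesis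 N' K → Odd (NumberField.discr K) → (Literature.NumberTheory.EllipticCurves.Rank1Residual.GoodOrd W' 3 ∨ Literature.NumberTheory.EllipticCurves.Rank1Residual.Mult W' 3 ∧ ¬ 3 ∣ padicValInt 3 W'.minimalDiscriminantInt ∨ Literature.NumberTheory.EllipticCurves.Rank1Residual.GoodSS W' 3 ∧ W'.frobeniusTrace 3 = 0) → ∀ (κ : Literature.NumberTheory.EllipticCurves.ZpExtension K 3), κ.IsAnticyclotomic → ∀ (γ : Field.absoluteGaloisGroup K) [Fact (κ.IsTopGenerator γ)] (𝔭 : IsDedekindDomain.HeightOneSpectrum (NumberField.RingOfIntegers K)), ((3 : ℕ) : NumberField.RingOfIntegers K) ∈ 𝔭.asIdeal → 𝔭.asIdeal.ramificationIdx (NumberField.RingOfIntegers ℚ) = 1 → 𝔭.asIdeal.inertiaDeg (NumberField.RingOfIntegers ℚ) = 1 → ∀ (𝔭' : IsDedekindDomain.HeightOneSpectrum (NumberField.RingOfIntegers K)), ((3 : ℕ) : NumberField.RingOfIntegers K) ∈ 𝔭'.asIdeal → 𝔭' ≠ 𝔭 → ∀ (ι' : PadicAlgCl 3 ≃+* ℂ),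 Summit.BirchSwinnertonDyer.BirchSwinnertonDyer.Theorems.SchneiderFree.BranchInducesPrime 3 ι' 𝔭 → ∀ (ΩK : ℂ) (Ωp : ℂ_[3]) (L' : Literature.NumberTheory.EllipticCurves.UnrSeries 3), ΩK ≠ 0 → Ωp ≠ 0 → Literature.NumberTheory.EllipticCurves.IsBDPLFunction ι' 𝔭 κ γ Dt'.f ΩK Ωp L' → ∃ i : ℕ, ‖((PowerSeries.coeff i L' : Literature.NumberTheory.EllipticCurves.unrIntegers 3) : ℂ_[3])‖ = 1)
    (h3 : (∀ (W' : WeierstrassCurve ℚ) [W'.IsElliptic] [W'.IsGloballyMinimal] (N' : ℕ) [NeZero N'] (K : Type) [Field K]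
      [NumberField K] (Dt' : ModularParametrizationData W' N'),
      Mult W' 3 → W'.HasSurjectiveModNGaloisRep 3 → W'.conductorNorm ℤ = N' → IsImaginaryQuadratic K →
      SatisfiesHeegnerHypothesis N' K → Odd (NumberField.discr K) → ¬ 3 ∣ padicValInt 3 W'.minimalDiscriminantInt →
      ∀ (κ : ZpExtension K 3), κ.IsAnticyclotomic → ∀ (γ : absoluteGaloisGroup K) [Fact (κ.IsTopGenerator γ)]
        (𝔭 : HeightOneSpectrum (𝓞 K)), ((3 : ℕ) : 𝓞 K) ∈ 𝔭.asIdeal →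
        𝔭.asIdeal.ramificationIdx (𝓞 ℚ) = 1 → 𝔭.asIdeal.inertiaDeg (𝓞 ℚ) = 1 →
        ∀ (𝔭' : HeightOneSpectrum (𝓞 K)), ((3 : ℕ) : 𝓞 K) ∈ 𝔭'.asIdeal → 𝔭' ≠ 𝔭 →
        ∀ (ι' : PadicAlgCl 3 ≃+* ℂ), SchneiderFree.BranchInducesPrime 3 ι' 𝔭 →
        ∃ (ΩK : ℂ) (Ωp : ℂ_[3]) (L : UnrSeries 3), ΩK ≠ 0 ∧ Ωp ≠ 0 ∧ IsBDPLFunction ι' 𝔭 κ γ Dt'.f ΩK Ωp L ∧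
          (Module.IsTorsion (IwasawaAlgebra 3) (XAc (W'.baseChange K) 3 κ 𝔭' ∅ γ) →
            ∀ (g : UnrSeries 3) (n m : ℕ),
              (XAc.charIdeal (W'.baseChange K) 3 κ 𝔭' ∅ γ).map (PowerSeries.map (toUnr 3)) = Ideal.span {g} →
              (∀ i < n, ‖((PowerSeries.coeff i g : unrIntegers 3) : ℂ_[3])‖ < 1) ∧
                  ‖((PowerSeries.coeff n g : unrIntegers 3) : ℂ_[3])‖ = 1 →
              (∀ i < m, ‖((PowerSeries.coeff i L : unrIntegers 3) : ℂ_[3])‖ < 1) ∧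
                  ‖((PowerSeries.coeff m L : unrIntegers 3) : ℂ_[3])‖ = 1 →
              m ≤ n)) ∧
      (∀ (W' : WeierstrassCurve ℚ) [W'.IsElliptic] [W'.IsGloballyMinimal] (N' : ℕ) [NeZero N'] (K : Type) [Field K]
      [NumberField K] (Dt' : ModularParametrizationData W' N'),
      GoodSS W' 3 → W'.frobeniusTrace 3 = 0 → W'.HasSurjectiveModNGaloisRep 3 → W'.conductorNorm ℤ = N' →
      IsImaginaryQuadratic K → SatisfiesHeegnerHypothesis N' K → Odd (NumberField.discr K) →
      ∀ (κ : ZpExtension K 3), κ.IsAnticyclotomic → ∀ (γ : absoluteGaloisGroup K) [Fact (κ.IsTopGenerator γ)]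
        (𝔭 : HeightOneSpectrum (𝓞 K)), ((3 : ℕ) : 𝓞 K) ∈ 𝔭.asIdeal →
        𝔭.asIdeal.ramificationIdx (𝓞 ℚ) = 1 → 𝔭.asIdeal.inertiaDeg (𝓞 ℚ) = 1 →
        ∀ (𝔭' : HeightOneSpectrum (𝓞 K)), ((3 : ℕ) : 𝓞 K) ∈ 𝔭'.asIdeal → 𝔭' ≠ 𝔭 →
        ∀ (ι' : PadicAlgCl 3 ≃+* ℂ), SchneiderFree.BranchInducesPrime 3 ι' 𝔭 →
        ∃ (ΩK : ℂ) (Ωp : ℂ_[3]) (L : UnrSeries 3), ΩK ≠ 0 ∧ Ωp ≠ 0 ∧ IsBDPLFunction ι' 𝔭 κ γ Dt'.f ΩK Ωp L ∧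
          (Module.IsTorsion (IwasawaAlgebra 3) (XAc (W'.baseChange K) 3 κ 𝔭' ∅ γ) →
            ∀ (g : UnrSeries 3) (n m : ℕ),
              (XAc.charIdeal (W'.baseChange K) 3 κ 𝔭' ∅ γ).map (PowerSeries.map (toUnr 3)) = Ideal.span {g} →
              (∀ i < n, ‖((PowerSeries.coeff i g : unrIntegers 3) : ℂ_[3])‖ < 1) ∧
                  ‖((PowerSeries.coeff n g : unrIntegers 3) : ℂ_[3])‖ = 1 →
              (∀ i < m, ‖((PowerSeries.coeff i L : unrIntegers 3) : ℂ_[3])‖ < 1) ∧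
                  ‖((PowerSeries.coeff m L : unrIntegers 3) : ℂ_[3])‖ = 1 →
              m ≤ n)))
    (hsupply : GoodSSApZeroTwinSupplyAtThree) (hres : PeuRamifieMultTwinResupplyAtThree)
    (hW : WildSplitPrintedInputsAtThree) (hS : WildSplitFrameAtThreeOddOfPrint) (hL : ToricPrintedLeavesAtThree)
    (hZ : WildRankZeroTwistAtThree) :
    ∀ (W : WeierstrassCurve ℚ) [W.IsElliptic] [W.IsGloballyMinimal], Additive.ClassO6 W 3 →
      W.analyticRank = 1 → W.HasSurjectiveModNGaloisRep 3 →
      (∃ (W' : WeierstrassCurve ℚ) (_ : W'.IsElliptic) (_ : W'.IsGloballyMinimal),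
        O6.ModPCongruent W' W 3 ∧ ¬ Addv W' 3 ∧ W'.HasSurjectiveModNGaloisRep 3) → BSDp W 3 := by
  -- p640116 §5 VERBATIM over §3″
  obtain ⟨hYZ, h1, h2⟩ := hL
  obtain ⟨hH, hB', hLZZ⟩ := hW
  obtain ⟨hB, hS0⟩ := h3
  exact bsdp_three_of_defectPT_of_degreeBucketsTR_odd_tMu hF hD hA hM h1 h2 hYZ
    (fun W' _ _ N' _ K _ _ Dt' hm hsurj hN hK hH hodd hnd κ hκ γ _ 𝔭 h𝔭 he hf 𝔭' h𝔭' hne ι' hι ↦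
      hB W' N' K Dt' hm hsurj hN hK hH hodd hnd κ hκ γ 𝔭 h𝔭 he hf 𝔭' h𝔭' hne ι' hι)
    (fun W' _ _ N' _ K _ _ Dt' hg ha hsurj hN hK hH hodd κ hκ γ _ 𝔭 h𝔭 he hf 𝔭' h𝔭' hne ι' hι ↦
      hS0 W' N' K Dt' hg ha hsurj hN hK hH hodd κ hκ γ 𝔭 h𝔭 he hf 𝔭' h𝔭' hne ι' hι)
    (fun W _ _ hO6 hr hsurj htwin ↦ hsupply W hO6 hr hsurj htwin)
    (fun W _ _ hO6 hr hsurj htwin ↦ hres W hO6 hr hsurj htwin)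
    (UniversalToricDescentKernelOdd.wildSplitWaldspurgerAtThreeOdd_of_lzz_of_frameOdd hLZZ (hS hH hB'))
    (UniversalToricDescentControl.wildSplitControlAtThree_of_poitouTate h1 h2) hZ

/-- **hK′ = kernel⁵ with RK-7's T-text in place of `TwinMuZeroAtThree`, all other antecedents BY NAME** — the literal text of the
successor of item 22543 (`ToricKernelAtThreeApZeroOddDegreeOfPrint`) under RK-7; its closer is
`fun hF hD hA hT h3 hsupply hres hW hS hL hZ ↦ kernelDeg_of_tText hF hD hA hT h3 hsupply hres hW hS hL hZ`. CONDITIONAL; BSD is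
proved for no curve by this. [folklore] -/
theorem kernelDeg_of_tText (hF : ToricPublishedInputs) (hD : DefectTransportModThreePT) (hA : AdditiveSplitIMCInclusionAtThree)
    (hM : ∀ (W : WeierstrassCurve ℚ) [W.IsElliptic] [W.IsGloballyMinimal] (W' : WeierstrassCurve ℚ) [W'.IsElliptic] [W'.IsGloballyMinimal] (N N' : ℕ) [NeZero N] [NeZero N'] (K : Type) [Field K] [NumberField K] (Dt : Literature.NumberTheory.EllipticCurves.ModularForms.ModularParametrizationData W N) (Dt' : Literature.NumberTheory.EllipticCurves.ModularForms.ModularParametrizationData W' N'), Summit.BirchSwinnertonDyer.Rank1Residual.Additive.ClassO6 W 3 → W.HasSurjectiveModNGaloisRep 3 → W.analyticRank = 1 → W.conductorNorm ℤ = N → Summit.BirchSwinnertonDyer.Rank1Residual.O6.ModPCongruent W' W 3 → ¬ Literature.NumberTheory.EllipticCurves.Rank1Residual.Addv W' 3 → W'.conductorNorm ℤ = N' → Literature.NumberTheory.EllipticCurves.IsImaginaryQuadratic K → Literature.NumberTheory.EllipticCurves.SatisfiesHeegnerHypothesis N K → Literature.NumberTheory.EllipticCurves.SatisfiesHeegnerHypothesis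 N' K → Odd (NumberField.discr K) → (Literature.NumberTheory.EllipticCurves.Rank1Residual.GoodOrd W' 3 ∨ Literature.NumberTheory.EllipticCurves.Rank1Residual.Mult W' 3 ∧ ¬ 3 ∣ padicValInt 3 W'.minimalDiscriminantInt ∨ Literature.NumberTheory.EllipticCurves.Rank1Residual.GoodSS W' 3 ∧ W'.frobeniusTrace 3 = 0) → ∀ (κ : Literature.NumberTheory.EllipticCurves.ZpExtension K 3), κ.IsAnticyclotomic → ∀ (γ : Field.absoluteGaloisGroup K) [Fact (κ.IsTopGenerator γ)] (𝔭 : IsDedekindDomain.HeightOneSpectrum (NumberField.RingOfIntegers K)), ((3 : ℕ) : NumberField.RingOfIntegers K) ∈ 𝔭.asIdeal → 𝔭.asIdeal.ramificationIdx (NumberField.RingOfIntegers ℚ) = 1 → 𝔭.asIdeal.inertiaDeg (NumberField.RingOfIntegers ℚ) = 1 → ∀ (𝔭' : IsDedekindDomain.HeightOneSpectrum (NumberField.RingOfIntegers K)), ((3 : ℕ) : NumberField.RingOfIntegers K) ∈ 𝔭'.asIdeal → 𝔭' ≠ 𝔭 → ∀ (ι' : PadicAlgCl 3 ≃+* ℂ),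 Summit.BirchSwinnertonDyer.BirchSwinnertonDyer.Theorems.SchneiderFree.BranchInducesPrime 3 ι' 𝔭 → ∀ (ΩK : ℂ) (Ωp : ℂ_[3]) (L' : Literature.NumberTheory.EllipticCurves.UnrSeries 3), ΩK ≠ 0 → Ωp ≠ 0 → Literature.NumberTheory.EllipticCurves.IsBDPLFunction ι' 𝔭 κ γ Dt'.f ΩK Ωp L' → ∃ i : ℕ, ‖((PowerSeries.coeff i L' : Literature.NumberTheory.EllipticCurves.unrIntegers 3) : ℂ_[3])‖ = 1)
    (h3 : TwinDegreeFrameAtThreeMultTresT ∧ TwinDegreeFrameAtThreeGoodSSApZeroT) (hsupply : GoodSSApZeroTwinSupplyAtThree)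
    (hres : PeuRamifieMultTwinResupplyAtThree) (hW : WildSplitPrintedInputsAtThree) (hS : WildSplitFrameAtThreeOddOfPrint)
    (hL : ToricPrintedLeavesAtThree) (hZ : WildRankZeroTwistAtThree) :
    ∀ (W : WeierstrassCurve ℚ) [W.IsElliptic] [W.IsGloballyMinimal], Additive.ClassO6 W 3 →
      W.analyticRank = 1 → W.HasSurjectiveModNGaloisRep 3 →
      (∃ (W' : WeierstrassCurve ℚ) (_ : W'.IsElliptic) (_ : W'.IsGloballyMinimal),
        O6.ModPCongruent W' W 3 ∧ ¬ Addv W' 3 ∧ W'.HasSurjectiveModNGaloisRep 3) → BSDp W 3 :=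
  bsdp_three_of_degreePackage_of_print_of_tText hF hD hA hM h3 hsupply hres hW hS hL hZ

/-- **hK″ = kernel⁵ in RK-7 v2's B-SHAPE (pen pss3x g9, `PEN-MEMO-RK7-v2.md` bb311f5e9220f088, Option B): the text of item 22543 with
`TwinMuZeroAtThree →` replaced by `BCSMuZeroInput → TwinMuZeroAtThreeMultOdd →`** (the print leaf 20790 BY NAME + the B residue's
text VERBATIM, 1989 characters of `RK7_sketch_pen_g8.lean` 51f2aaf68cacd05b), all other antecedents BY NAME. Proof: the T-text from
`…TwinMuZeroT.twinMuZeroAtThreeT_of_bcs422_of_multOdd h422 hB` (p722155), then `kernelDeg_of_tText`. Once the pen files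
`TwinMuZeroAtThreeMultOdd` (a `def` unfolding to this text) and hK″ `ToricKernelAtThreeApZeroOddDegreeMuBOfPrint`, the closer of hK″ is
`by intro hF hD hA h422 hB h3 hsupply hres hW hS hL hZ; exact kernelDeg_of_bcs422_of_multOdd hF hD hA h422 hB h3 hsupply hres hW hS hL hZ`.
CONDITIONAL on every displayed antecedent (h422 = BCS 2025 Prop. 4.2.2 is a printed named fact; B is research); BSD is proved for no
curve by this. [cite: BurungaleCastellaSkinner2025, Prop. 4.2.2 (§4.2, pp. 8–9 of arXiv:2405.00270v2)] -/
theorem kernelDeg_of_bcs422_of_multOdd (hF : ToricPublishedInputs) (hD : DefectTransportModThreePT)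
    (hA : AdditiveSplitIMCInclusionAtThree) (h422 : BCSMuZeroInput)
    (hB : ∀ (W : WeierstrassCurve ℚ) [W.IsElliptic] [W.IsGloballyMinimal] (W' : WeierstrassCurve ℚ) [W'.IsElliptic] [W'.IsGloballyMinimal] (N N' : ℕ) [NeZero N] [NeZero N'] (K : Type) [Field K] [NumberField K] (Dt : Literature.NumberTheory.EllipticCurves.ModularForms.ModularParametrizationData W N) (Dt' : Literature.NumberTheory.EllipticCurves.ModularForms.ModularParametrizationData W' N'), Summit.BirchSwinnertonDyer.Rank1Residual.Additive.ClassO6 W 3 → W.HasSurjectiveModNGaloisRep 3 → W.analyticRank = 1 → W.conductorNorm ℤ = N → Summit.BirchSwinnertonDyer.Rank1Residual.O6.ModPCongruent W' W 3 → ¬ Literature.NumberTheory.EllipticCurves.Rank1Residual.Addv W' 3 → W'.conductorNorm ℤ = N' → Literature.NumberTheory.EllipticCurves.IsImaginaryQuadratic K → Literature.NumberTheory.EllipticCurves.SatisfiesHeegnerHypothesis N K → Literature.NumberTheory.EllipticCurves.SatisfiesHeegnerHypothesis N' K → Odd (NumberField.discr K) → (Literature.NumberTheory.EllipticCurves.Rank1Residual.Mult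 W' 3 ∧ ¬ 3 ∣ padicValInt 3 W'.minimalDiscriminantInt) → ∀ (κ : Literature.NumberTheory.EllipticCurves.ZpExtension K 3), κ.IsAnticyclotomic → ∀ (γ : Field.absoluteGaloisGroup K) [Fact (κ.IsTopGenerator γ)] (𝔭 : IsDedekindDomain.HeightOneSpectrum (NumberField.RingOfIntegers K)), ((3 : ℕ) : NumberField.RingOfIntegers K) ∈ 𝔭.asIdeal → 𝔭.asIdeal.ramificationIdx (NumberField.RingOfIntegers ℚ) = 1 → 𝔭.asIdeal.inertiaDeg (NumberField.RingOfIntegers ℚ) = 1 → ∀ (𝔭' : IsDedekindDomain.HeightOneSpectrum (NumberField.RingOfIntegers K)), ((3 : ℕ) : NumberField.RingOfIntegers K) ∈ 𝔭'.asIdeal → 𝔭' ≠ 𝔭 → ∀ (ι' : PadicAlgCl 3 ≃+* ℂ), Summit.BirchSwinnertonDyer.BirchSwinnertonDyer.Theorems.SchneiderFree.BranchInducesPrime 3 ι' 𝔭 → ∀ (ΩK : ℂ) (Ωp : ℂ_[3]) (L' : Literature.NumberTheory.EllipticCurves.UnrSeries 3), ΩK ≠ 0 → Ωp ≠ 0 →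 Literature.NumberTheory.EllipticCurves.IsBDPLFunction ι' 𝔭 κ γ Dt'.f ΩK Ωp L' → ∃ i : ℕ, ‖((PowerSeries.coeff i L' : Literature.NumberTheory.EllipticCurves.unrIntegers 3) : ℂ_[3])‖ = 1)
    (h3 : TwinDegreeFrameAtThreeMultTresT ∧ TwinDegreeFrameAtThreeGoodSSApZeroT) (hsupply : GoodSSApZeroTwinSupplyAtThree)
    (hres : PeuRamifieMultTwinResupplyAtThree) (hW : WildSplitPrintedInputsAtThree) (hS : WildSplitFrameAtThreeOddOfPrint)
    (hL : ToricPrintedLeavesAtThree) (hZ : WildRankZeroTwistAtThree) :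
    ∀ (W : WeierstrassCurve ℚ) [W.IsElliptic] [W.IsGloballyMinimal], Additive.ClassO6 W 3 →
      W.analyticRank = 1 → W.HasSurjectiveModNGaloisRep 3 →
      (∃ (W' : WeierstrassCurve ℚ) (_ : W'.IsElliptic) (_ : W'.IsGloballyMinimal),
        O6.ModPCongruent W' W 3 ∧ ¬ Addv W' 3 ∧ W'.HasSurjectiveModNGaloisRep 3) → BSDp W 3 :=
  kernelDeg_of_tText hF hD hA (UniversalToricDescentTwinMuZeroT.twinMuZeroAtThreeT_of_bcs422_of_multOdd h422 hB) h3 hsupply hres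
    hW hS hL hZ

end Summit.BirchSwinnertonDyer.BirchSwinnertonDyer.Theorems.UniversalToricDescentKernelDegreeOnlyTwinT

end
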